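import Mathlib
import HarnessLib

/-!
# Coefficient identity for non-negative multivariate power series (line `positive-cone-weight-doubling`)

Crux `Summit.CriticalPhenomena.CardyFormulaZ2.Theses.CardyMagicRigidity.NestingRigidity`
(stmt-CriticalPhenomena-4835), line `positive-cone-weight-doubling`, helper toward the registered stub
`stub_pgfUniqueness` (PGF uniqueness in limit form). Pure analysis, no percolation vocabulary. For a
finite index type `ι`, multi-indices `k : ι → ℕ` of degree `|k| = Σ i, k i` and monomials
`u^k = ∏ i, u i ^ k i`:

* §1 `summable_prod_pow_of_lt_one` — `Σ_k ∏ i, θ i ^ k i < ∞` for `0 ≤ θ i < 1` (iterated geometric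
  series), and the comparison lemma `summable_mul_prod_pow_of_le`;
* §2 `sum_fiber_eq_zero_of_eventually_eq_zero` — IDENTITY THEOREM ALONG A RAY: if
  `Σ_k |w k| ρ^{|k|} < ∞` for some `ρ > 1` and `t ↦ Σ_k w k t^{|k|}` vanishes for `t` near `1`, then
  every homogeneous component `Σ_{|k| = m} w k` vanishes (`FormalMultilinearSeries.ofScalars` of
  radius `≥ ρ > 1`, `AnalyticOnNhd.eqOn_zero_of_preconnected_of_eventuallyEq_zero` on the ball,
  `HasFPowerSeriesAt.eq_zero_of_eventually`);
* §3 `eq_zero_of_sum_monomial_eq_zero` — a finite linear combination of monomials vanishing on a box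
  with infinite sides has zero coefficients (`MvPolynomial.funext_set`);
* §4 `eq_of_tsum_mul_prod_pow_eq` — THE COEFFICIENT IDENTITY: two non-negative coefficient families
  `p, q`, summable against `c^k`, whose generating functions `Σ_k p k u^k`, `Σ_k q k u^k` agree on a
  non-empty open subset of the box `{u | 0 < u < c}`, are equal (rays `t ↦ t • u` through the open
  set and §2, then §3 on a small box);
* §5 `tendsto_coeff_sub_of_tsum` (registered helper) — THE LIMIT FORM: two sequences of
  `[0,1]`-valued coefficient families whose generating functions are eventually bounded and
  asymptotically equal on a non-empty open set of positive vectors are asymptotically equal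
  coefficientwise (sequential compactness of `([0,1]²)^{ℕ^ι}`, Tannery's theorem below a point of
  the open set, §4, `Filter.tendsto_of_subseq_tendsto`).
-/

noncomputable section

open Set Filter Metric
open scoped Topology BigOperators ENNReal NNReal

namespace Summit.CriticalPhenomena.CardyFormulaZ2.Cruxes.NestingRigidity.PositiveConeWeightDoubling

variable {ι : Type*} [Fintype ι]

/-! ## §1 Iterated geometric series -/

/-- `Σ_{k : Fin m → ℕ} ∏ i, θ i ^ k i < ∞` for `0 ≤ θ i < 1` (induction on `m`: split off the first
coordinate, `Fin.consEquiv`, and multiply a geometric series with the induction hypothesis). -/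
theorem summable_prod_pow_fin : ∀ (m : ℕ) (θ : Fin m → ℝ), (∀ i, 0 ≤ θ i) → (∀ i, θ i < 1) →
    Summable fun k : Fin m → ℕ ↦ ∏ i, θ i ^ k i := by
  intro m
  induction m with
  | zero => intro θ _ _; exact Summable.of_finite
  | succ m ih =>
    intro θ h0 h1
    have h := (summable_geometric_of_lt_one (h0 0) (h1 0)).mul_of_nonneg
      (ih (fun i ↦ θ i.succ) (fun i ↦ h0 _) fun i ↦ h1 _) (fun a ↦ pow_nonneg (h0 0) a)
      fun k ↦ Finset.prod_nonneg fun i _ ↦ pow_nonneg (h0 _) _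
    rw [← (Fin.consEquiv fun _ ↦ ℕ).summable_iff]
    convert h using 2 with x
    simp only [Function.comp_apply, Fin.consEquiv_apply, Fin.prod_univ_succ, Fin.cons_zero,
      Fin.cons_succ]

/-- `Σ_{k : ι → ℕ} ∏ i, θ i ^ k i < ∞` for `0 ≤ θ i < 1` (transport of `summable_prod_pow_fin` along
an enumeration of `ι`). -/
theorem summable_prod_pow_of_lt_one {θ : ι → ℝ} (h0 : ∀ i, 0 ≤ θ i) (h1 : ∀ i, θ i < 1) :
    Summable fun k : ι → ℕ ↦ ∏ i, θ i ^ k i := by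
  set e := Fintype.equivFin ι
  have h := summable_prod_pow_fin (Fintype.card ι) (fun j ↦ θ (e.symm j)) (fun j ↦ h0 _)
    fun j ↦ h1 _
  have h' := (Equiv.piCongrLeft' (fun _ : ι ↦ ℕ) e).summable_iff.2 h
  convert h' using 2 with k
  simp only [Function.comp_apply, Equiv.piCongrLeft'_apply]
  exact Fintype.prod_equiv e _ _ fun i ↦ by simp

/-- Comparison: a non-negative family summable against `c^k` is summable against `v^k` for every
`0 ≤ v ≤ c`. -/
theorem summable_mul_prod_pow_of_le {p : (ι → ℕ) → ℝ} (hp : ∀ k, 0 ≤ p k) {c v : ι → ℝ}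
    (hv : ∀ i, 0 ≤ v i ∧ v i ≤ c i) (hps : Summable fun k ↦ p k * ∏ i, c i ^ k i) :
    Summable fun k ↦ p k * ∏ i, v i ^ k i :=
  Summable.of_nonneg_of_le (fun k ↦ mul_nonneg (hp k) (Finset.prod_nonneg fun i _ ↦
    pow_nonneg (hv i).1 _)) (fun k ↦ mul_le_mul_of_nonneg_left (Finset.prod_le_prod
      (fun i _ ↦ pow_nonneg (hv i).1 _) fun i _ ↦ pow_le_pow_left₀ (hv i).1 (hv i).2 _) (hp k)) hps

/-- The multi-indices of a given degree form a finite set. -/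
theorem exists_finset_deg_eq (m : ℕ) : ∃ K : Finset (ι → ℕ), ∀ k, k ∈ K ↔ ∑ i, k i = m := by
  classical
  refine ⟨(Fintype.piFinset fun _ ↦ Finset.range (m + 1)).filter fun k ↦ ∑ i, k i = m, fun k ↦ ?_⟩
  simp only [Finset.mem_filter, Fintype.mem_piFinset, Finset.mem_range, and_iff_right_iff_imp]
  intro hk i
  have : k i ≤ ∑ j, k j := Finset.single_le_sum (fun j _ ↦ Nat.zero_le (k j)) (Finset.mem_univ i)
  omega

/-! ## §2 The identity theorem along a ray -/

/-- **Homogeneous components of a power series vanishing near `t = 1` vanish.** If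
`Σ_k |w k| ρ^{|k|} < ∞` for some `ρ > 1` and `Σ_k w k t^{|k|} = 0` for all `t` near `1`, then
`Σ_{k ∈ K} w k = 0` for every finite set `K` of multi-indices cut out by a degree condition
`|k| = m`. -/
theorem sum_fiber_eq_zero_of_eventually_eq_zero {w : (ι → ℕ) → ℝ} {ρ : ℝ} (hρ : 1 < ρ)
    (hw : Summable fun k ↦ |w k| * ρ ^ ∑ i, k i)
    (h0 : ∀ᶠ t in 𝓝 (1 : ℝ), ∑' k, w k * t ^ ∑ i, k i = 0)
    (m : ℕ) (K : Finset (ι → ℕ)) (hK : ∀ k, k ∈ K ↔ ∑ i, k i = m) : ∑ k ∈ K, w k = 0 := by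
  set dg : (ι → ℕ) → ℕ := fun k ↦ ∑ i, k i with hdg
  set e : ℕ → ℝ := fun j ↦ ∑' k : ↥(dg ⁻¹' {j}), w k with he
  have hρ0 : (0 : ℝ) ≤ ρ := by linarith
  -- summability of the ray series for `|t| < ρ`, and of `|w|`
  have hsum : ∀ t : ℝ, |t| < ρ → Summable fun k ↦ w k * t ^ dg k := by
    intro t ht
    refine Summable.of_abs (Summable.of_nonneg_of_le (fun k ↦ abs_nonneg _) (fun k ↦ ?_) hw)
    rw [abs_mul, abs_pow]
    exact mul_le_mul_of_nonneg_left (pow_le_pow_left₀ (abs_nonneg t) ht.le _) (abs_nonneg _)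
  have hwabs : Summable fun k ↦ |w k| := Summable.of_nonneg_of_le (fun k ↦ abs_nonneg _)
    (fun k ↦ le_mul_of_one_le_right (abs_nonneg _) (one_le_pow₀ hρ.le)) hw
  have hfib : ∀ (f : (ι → ℕ) → ℝ) (j : ℕ) (t : ℝ),
      ∑' k : ↥(dg ⁻¹' {j}), f k * t ^ dg k = (∑' k : ↥(dg ⁻¹' {j}), f k) * t ^ j := fun f j t ↦ by
    rw [← tsum_mul_right]
    exact tsum_congr fun k ↦ by rw [show dg k.1 = j from k.2]
  have hser : ∀ t : ℝ, |t| < ρ → HasSum (fun j ↦ e j * t ^ j) (∑' k, w k * t ^ dg k) := by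
    intro t ht
    have h := (hsum t ht).hasSum.tsum_fiberwise dg
    simp only [hfib w] at h
    exact h
  -- coefficient bound: `|e j| ρ^j ≤ C`
  have hbound : ∀ j, |e j| * ρ ^ j ≤ ∑' k, |w k| * ρ ^ dg k := by
    intro j
    have h1 : |e j| ≤ ∑' k : ↥(dg ⁻¹' {j}), |w k| := by
      have := norm_tsum_le_tsum_norm (f := fun k : ↥(dg ⁻¹' {j}) ↦ w k)
        (by simpa only [Real.norm_eq_abs, Function.comp_def] using hwabs.subtype _)
      simpa only [Real.norm_eq_abs] using this
    calc |e j| * ρ ^ j ≤ (∑' k : ↥(dg ⁻¹' {j}), |w k|) * ρ ^ j :=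
          mul_le_mul_of_nonneg_right h1 (pow_nonneg hρ0 _)
      _ = ∑' k : ↥(dg ⁻¹' {j}), |w k| * ρ ^ dg k := (hfib (fun k ↦ |w k|) j ρ).symm
      _ ≤ ∑' k, |w k| * ρ ^ dg k :=
          Summable.tsum_subtype_le (fun k ↦ |w k| * ρ ^ dg k) _
            (fun k ↦ mul_nonneg (abs_nonneg _) (pow_nonneg hρ0 _)) hw
  -- the formal power series and its radius
  set P : FormalMultilinearSeries ℝ ℝ ℝ := FormalMultilinearSeries.ofScalars ℝ e with hP
  set r : ℝ≥0 := ⟨ρ, hρ0⟩ with hr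
  have hr1 : (1 : ℝ≥0) < r := by rw [← NNReal.coe_lt_coe, NNReal.coe_one]; exact hρ
  have hrad : (r : ℝ≥0∞) ≤ P.radius := by
    refine P.le_radius_of_bound (∑' k, |w k| * ρ ^ dg k) fun j ↦ ?_
    rw [hP, FormalMultilinearSeries.ofScalars_norm, Real.norm_eq_abs]
    exact hbound j
  have hpos : 0 < P.radius := lt_of_lt_of_le (ENNReal.coe_pos.2 (lt_trans one_pos hr1)) hrad
  have hF : HasFPowerSeriesOnBall P.sum P 0 P.radius := P.hasFPowerSeriesOnBall hpos
  have hPsum : ∀ t : ℝ, P.sum t = ∑' j, e j * t ^ j := fun t ↦ by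
    have := FormalMultilinearSeries.ofScalars_sum_eq e t
    simpa only [FormalMultilinearSeries.ofScalarsSum, smul_eq_mul] using this
  -- `P.sum` vanishes near `1`, a point of the ball of convergence
  have h1ball : (1 : ℝ) ∈ Metric.eball (0 : ℝ) P.radius := by
    rw [Metric.mem_eball]
    refine lt_of_lt_of_le ?_ hrad
    rw [edist_dist, dist_zero_right, norm_one, ENNReal.ofReal_one]
    exact ENNReal.one_lt_coe_iff.2 hr1
  have hzero : P.sum =ᶠ[𝓝 (1 : ℝ)] 0 := by
    have hlt : ∀ᶠ t in 𝓝 (1 : ℝ), |t| < ρ :=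
      continuous_abs.continuousAt.eventually_lt continuousAt_const (by simpa using hρ)
    filter_upwards [h0, hlt] with t ht hlt'
    rw [Pi.zero_apply, hPsum t, (hser t hlt').tsum_eq]
    exact ht
  have hEq : EqOn P.sum 0 (Metric.eball (0 : ℝ) P.radius) :=
    hF.analyticOnNhd.eqOn_zero_of_preconnected_of_eventuallyEq_zero Metric.isPreconnected_eball
      h1ball hzero
  have hzero0 : P.sum =ᶠ[𝓝 (0 : ℝ)] 0 :=
    hEq.eventuallyEq_of_mem (Metric.isOpen_eball.mem_nhds (Metric.mem_eball_self hpos))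
  have hP0 : P = 0 := hF.hasFPowerSeriesAt.eq_zero_of_eventually hzero0
  have he0 : e = 0 := (FormalMultilinearSeries.ofScalars_series_eq_zero (E := ℝ)).1 hP0
  -- read off the `m`-th coefficient
  have hKm : dg ⁻¹' {m} = ↑K :=
    Set.ext fun k ↦ by rw [Set.mem_preimage, Set.mem_singleton_iff, Finset.mem_coe, hK k]
  rw [← Finset.tsum_subtype' K w, ← tsum_congr_set_coe w hKm]
  change e m = 0
  rw [he0, Pi.zero_apply]

/-! ## §3 Monomials are linearly independent on a box -/

/-- A finite linear combination of monomials `u ↦ ∏ i, u i ^ k i` vanishing on a box with infinite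
sides has all coefficients zero (`MvPolynomial.funext_set`). -/
theorem eq_zero_of_sum_monomial_eq_zero {d : (ι → ℕ) → ℝ} (K : Finset (ι → ℕ)) {s : ι → Set ℝ}
    (hs : ∀ i, (s i).Infinite)
    (h : ∀ u ∈ Set.pi Set.univ s, ∑ k ∈ K, d k * ∏ i, u i ^ k i = 0) : ∀ k ∈ K, d k = 0 := by
  classical
  set φ : MvPolynomial ι ℝ :=
    ∑ k ∈ K, MvPolynomial.monomial (Finsupp.equivFunOnFinite.symm k) (d k) with hφ
  have heval : ∀ u : ι → ℝ, MvPolynomial.eval u φ = ∑ k ∈ K, d k * ∏ i, u i ^ k i := by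
    intro u
    rw [hφ, map_sum]
    refine Finset.sum_congr rfl fun k _ ↦ ?_
    rw [MvPolynomial.eval_monomial, Finsupp.prod_fintype _ _ fun i ↦ pow_zero _]
    rfl
  have hφ0 : φ = 0 := MvPolynomial.funext_set s hs fun u hu ↦ by rw [heval, h u hu, map_zero]
  intro k hk
  have hc := congrArg (MvPolynomial.coeff (Finsupp.equivFunOnFinite.symm k)) hφ0
  rw [MvPolynomial.coeff_zero, hφ, MvPolynomial.coeff_sum] at hc
  simp only [MvPolynomial.coeff_monomial, EmbeddingLike.apply_eq_iff_eq, Finset.sum_ite_eq',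
    if_pos hk] at hc
  exact hc

/-! ## §4 The coefficient identity -/

/-- **Non-negative multivariate power series agreeing on an open set have equal coefficients.**
If `p, q ≥ 0` are summable against `c^k`, and `Σ_k p k u^k = Σ_k q k u^k` for all `u` in a non-empty
open subset `V` of the box `{u | ∀ i, 0 < u i < c i}`, then `p = q`.  Proof: for `u ∈ V` the
one-variable series `t ↦ Σ_k (p k - q k) u^k t^{|k|}` converges for `|t| < ρ` with some `ρ > 1`
(`ρ • u < c`) and vanishes for `t` near `1` (`t • u ∈ V`), so its homogeneous components
`Σ_{|k| = m} (p k - q k) u^k` vanish on `V` (§2); each is a polynomial vanishing on a box inside `V`,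
hence has zero coefficients (§3). -/
theorem eq_of_tsum_mul_prod_pow_eq {p q : (ι → ℕ) → ℝ} (hp : ∀ k, 0 ≤ p k) (hq : ∀ k, 0 ≤ q k)
    {c : ι → ℝ} (hps : Summable fun k ↦ p k * ∏ i, c i ^ k i)
    (hqs : Summable fun k ↦ q k * ∏ i, c i ^ k i) {V : Set (ι → ℝ)} (hV : IsOpen V)
    (hVne : V.Nonempty) (hVc : ∀ u ∈ V, ∀ i, 0 < u i ∧ u i < c i)
    (heq : ∀ u ∈ V, ∑' k, p k * ∏ i, u i ^ k i = ∑' k, q k * ∏ i, u i ^ k i) : p = q := by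
  classical
  -- an open box with infinite sides inside `V`
  obtain ⟨u₀, hu₀⟩ := hVne
  obtain ⟨ε, hε, hball⟩ := Metric.isOpen_iff.1 hV u₀ hu₀
  set s : ι → Set ℝ := fun i ↦ Ioo (u₀ i - ε) (u₀ i + ε) with hs_def
  have hsV : Set.pi univ s ⊆ V := fun u hu ↦ hball (by
    rw [ball_pi _ hε]
    exact fun i _ ↦ by simp only [Real.ball_eq_Ioo]; exact hu i (mem_univ _))
  have hsinf : ∀ i, (s i).Infinite := fun i ↦ Ioo_infinite (by linarith)
  -- every homogeneous component of `Σ_k (p k - q k) u^k` vanishes on `V`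
  have key : ∀ u ∈ V, ∀ (m : ℕ) (K : Finset (ι → ℕ)), (∀ k, k ∈ K ↔ ∑ i, k i = m) →
      ∑ k ∈ K, (p k - q k) * ∏ i, u i ^ k i = 0 := by
    intro u hu m K hK
    have hu' := hVc u hu
    -- a dilation factor `ρ > 1` keeping `ρ • u` below `c`
    have hev : ∀ᶠ ρ in 𝓝 (1 : ℝ), ∀ i, ρ * u i < c i :=
      eventually_all.2 fun i ↦ (continuous_id.mul continuous_const).continuousAt.eventually_lt
        continuousAt_const (by simpa using (hu' i).2)
    obtain ⟨ρ, hρ1, hρc⟩ := (eventually_mem_nhdsWithin.and (nhdsWithin_le_nhds hev) :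
      ∀ᶠ ρ in 𝓝[>] (1 : ℝ), ρ ∈ Ioi 1 ∧ ∀ i, ρ * u i < c i).exists
    replace hρ1 : 1 < ρ := hρ1
    refine sum_fiber_eq_zero_of_eventually_eq_zero
      (w := fun k ↦ (p k - q k) * ∏ i, u i ^ k i) hρ1 ?_ ?_ m K hK
    · -- `Σ_k |p k - q k| u^k ρ^{|k|} ≤ Σ_k (p k + q k) c^k < ∞`
      refine Summable.of_nonneg_of_le (fun k ↦ by positivity) (fun k ↦ ?_) (hps.add hqs)
      have hmono : (∏ i, u i ^ k i) * ρ ^ ∑ i, k i ≤ ∏ i, c i ^ k i := by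
        rw [← Finset.prod_pow_eq_pow_sum, ← Finset.prod_mul_distrib]
        refine Finset.prod_le_prod (fun i _ ↦ mul_nonneg (pow_nonneg (hu' i).1.le _)
          (pow_nonneg (by linarith) _)) fun i _ ↦ ?_
        rw [← mul_pow]
        refine pow_le_pow_left₀ (mul_nonneg (hu' i).1.le (by linarith)) ?_ _
        rw [mul_comm]
        exact (hρc i).le
      have hprod : 0 ≤ ∏ i, u i ^ k i := Finset.prod_nonneg fun i _ ↦ pow_nonneg (hu' i).1.le _
      calc |(p k - q k) * ∏ i, u i ^ k i| * ρ ^ ∑ i, k i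
          = |p k - q k| * ((∏ i, u i ^ k i) * ρ ^ ∑ i, k i) := by
            rw [abs_mul, abs_of_nonneg hprod, mul_assoc]
        _ ≤ (p k + q k) * ∏ i, c i ^ k i := by
            refine mul_le_mul ?_ hmono (mul_nonneg hprod (pow_nonneg (by linarith) _))
              (add_nonneg (hp k) (hq k))
            rw [abs_le]
            constructor <;> linarith [hp k, hq k]
        _ = p k * ∏ i, c i ^ k i + q k * ∏ i, c i ^ k i := by ring
    · -- the ray series vanishes for `t` near `1` (`t • u ∈ V`)
      have hcont : Tendsto (fun t : ℝ ↦ t • u) (𝓝 1) (𝓝 ((1 : ℝ) • u)) :=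
        tendsto_id.smul tendsto_const_nhds
      rw [one_smul] at hcont
      filter_upwards [hcont (hV.mem_nhds hu)] with t ht
      have htu := hVc _ ht
      have hsp : Summable fun k ↦ p k * ∏ i, (t • u) i ^ k i :=
        summable_mul_prod_pow_of_le hp (fun i ↦ ⟨(htu i).1.le, (htu i).2.le⟩) hps
      have hsq : Summable fun k ↦ q k * ∏ i, (t • u) i ^ k i :=
        summable_mul_prod_pow_of_le hq (fun i ↦ ⟨(htu i).1.le, (htu i).2.le⟩) hqs
      have hray : ∀ k : ι → ℕ, (p k - q k) * (∏ i, u i ^ k i) * t ^ ∑ i, k i =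
          p k * ∏ i, (t • u) i ^ k i - q k * ∏ i, (t • u) i ^ k i := fun k ↦ by
        have : (∏ i, u i ^ k i) * t ^ ∑ i, k i = ∏ i, (t • u) i ^ k i := by
          rw [← Finset.prod_pow_eq_pow_sum, ← Finset.prod_mul_distrib]
          exact Finset.prod_congr rfl fun i _ ↦ by rw [Pi.smul_apply, smul_eq_mul, mul_pow, mul_comm]
        rw [mul_assoc, this, sub_mul]
      simp only [hray]
      rw [hsp.tsum_sub hsq, heq _ ht, sub_self]
  -- conclusion: coefficientwise, via §3 on the box
  funext k₀
  obtain ⟨K, hK⟩ := exists_finset_deg_eq (ι := ι) (∑ i, k₀ i)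
  have hk₀ : k₀ ∈ K := (hK k₀).2 rfl
  exact sub_eq_zero.1
    (eq_zero_of_sum_monomial_eq_zero K hsinf (fun u hu ↦ key u (hsV hu) _ K hK) k₀ hk₀)

/-! ## §5 Limit form: two sequences of sub-probability coefficient families -/

/-- **One convergent coefficient sequence.** If `a j ≥ 0` converges coefficientwise to `p` and the
generating functions at a positive point `u₁` are eventually bounded by `M`, then `p` is summable
against `u₁^k` (bounded partial sums) and, for every `0 ≤ u < u₁`, `Σ_k a j k u^k → Σ_k p k u^k`
(Tannery's theorem with the summable bound `M (u/u₁)^k`, `summable_prod_pow_of_lt_one`). -/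
theorem tendsto_tsum_of_tendsto_coeff {a : ℕ → (ι → ℕ) → ℝ} (ha0 : ∀ j k, 0 ≤ a j k)
    {u₁ : ι → ℝ} (hu₁ : ∀ i, 0 < u₁ i) {M : ℝ}
    (hM : ∀ᶠ j in atTop, Summable (fun k ↦ a j k * ∏ i, u₁ i ^ k i) ∧
      ∑' k, a j k * ∏ i, u₁ i ^ k i ≤ M)
    {p : (ι → ℕ) → ℝ} (hp : ∀ k, Tendsto (fun j ↦ a j k) atTop (𝓝 (p k))) :
    Summable (fun k ↦ p k * ∏ i, u₁ i ^ k i) ∧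
      ∀ u : ι → ℝ, (∀ i, 0 ≤ u i ∧ u i < u₁ i) →
        Tendsto (fun j ↦ ∑' k, a j k * ∏ i, u i ^ k i) atTop (𝓝 (∑' k, p k * ∏ i, u i ^ k i)) := by
  have hp0 : ∀ k, 0 ≤ p k := fun k ↦ ge_of_tendsto' (hp k) fun j ↦ ha0 j k
  have hmono0 : ∀ (v : ι → ℝ) (k : ι → ℕ), (∀ i, 0 ≤ v i) → 0 ≤ ∏ i, v i ^ k i :=
    fun v k hv ↦ Finset.prod_nonneg fun i _ ↦ pow_nonneg (hv i) _
  have hps : Summable fun k ↦ p k * ∏ i, u₁ i ^ k i := by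
    refine summable_of_sum_le (c := M)
      (fun k ↦ mul_nonneg (hp0 k) (hmono0 u₁ k fun i ↦ (hu₁ i).le)) fun F ↦ ?_
    have hF : Tendsto (fun j ↦ ∑ k ∈ F, a j k * ∏ i, u₁ i ^ k i) atTop
        (𝓝 (∑ k ∈ F, p k * ∏ i, u₁ i ^ k i)) :=
      tendsto_finsetSum F fun k _ ↦ (hp k).mul_const _
    exact le_of_tendsto hF (hM.mono fun j hj ↦ (hj.1.sum_le_tsum F fun k _ ↦
      mul_nonneg (ha0 j k) (hmono0 u₁ k fun i ↦ (hu₁ i).le)).trans hj.2)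
  refine ⟨hps, fun u hu ↦ ?_⟩
  set θ : ι → ℝ := fun i ↦ u i / u₁ i with hθ
  have hθ0 : ∀ i, 0 ≤ θ i := fun i ↦ div_nonneg (hu i).1 (hu₁ i).le
  have hθ1 : ∀ i, θ i < 1 := fun i ↦ (div_lt_one (hu₁ i)).2 (hu i).2
  have hsplit : ∀ k : ι → ℕ, ∏ i, u i ^ k i = (∏ i, u₁ i ^ k i) * ∏ i, θ i ^ k i := fun k ↦ by
    rw [← Finset.prod_mul_distrib]
    refine Finset.prod_congr rfl fun i _ ↦ ?_
    rw [← mul_pow, hθ, mul_div_cancel₀ _ (hu₁ i).ne']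
  refine tendsto_tsum_of_dominated_convergence (bound := fun k ↦ M * ∏ i, θ i ^ k i)
    ((summable_prod_pow_of_lt_one hθ0 hθ1).mul_left M) (fun k ↦ (hp k).mul_const _) ?_
  filter_upwards [hM] with j hj k
  rw [Real.norm_eq_abs, abs_of_nonneg (mul_nonneg (ha0 j k) (hmono0 u k fun i ↦ (hu i).1)),
    hsplit, ← mul_assoc]
  exact mul_le_mul_of_nonneg_right ((hj.1.le_tsum k fun k' _ ↦ mul_nonneg (ha0 j k')
    (hmono0 u₁ k' fun i ↦ (hu₁ i).le)).trans hj.2) (hmono0 θ k hθ0)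

/-- **Identification of subsequential limits.** Two non-negative coefficient sequences `a j, b j`
whose generating functions are eventually bounded and asymptotically equal on a non-empty open set
`U` of positive vectors, and which converge coefficientwise to `p` and `q`, have `p = q`
(`tendsto_tsum_of_tendsto_coeff` on the box below a point `u₁ ∈ U`, then the coefficient identity
`eq_of_tsum_mul_prod_pow_eq` on `U ∩ {u < u₁}`). -/
theorem eq_of_tendsto_coeff {a b : ℕ → (ι → ℕ) → ℝ} (ha0 : ∀ j k, 0 ≤ a j k)
    (hb0 : ∀ j k, 0 ≤ b j k) {U : Set (ι → ℝ)} (hU : IsOpen U) (hUne : U.Nonempty)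
    (hUpos : ∀ u ∈ U, ∀ i, 0 < u i)
    (hbd : ∀ u ∈ U, ∃ M : ℝ, ∀ᶠ j in atTop,
      (Summable (fun k ↦ a j k * ∏ i, u i ^ k i) ∧ ∑' k, a j k * ∏ i, u i ^ k i ≤ M) ∧
        (Summable (fun k ↦ b j k * ∏ i, u i ^ k i) ∧ ∑' k, b j k * ∏ i, u i ^ k i ≤ M))
    (hlim : ∀ u ∈ U, Tendsto (fun j ↦ ∑' k, a j k * ∏ i, u i ^ k i -
      ∑' k, b j k * ∏ i, u i ^ k i) atTop (𝓝 0))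
    {p q : (ι → ℕ) → ℝ} (hp : ∀ k, Tendsto (fun j ↦ a j k) atTop (𝓝 (p k)))
    (hq : ∀ k, Tendsto (fun j ↦ b j k) atTop (𝓝 (q k))) : p = q := by
  have hp0 : ∀ k, 0 ≤ p k := fun k ↦ ge_of_tendsto' (hp k) fun j ↦ ha0 j k
  have hq0 : ∀ k, 0 ≤ q k := fun k ↦ ge_of_tendsto' (hq k) fun j ↦ hb0 j k
  obtain ⟨u₁, hu₁⟩ := hUne
  obtain ⟨M, hM⟩ := hbd u₁ hu₁
  have hu₁pos := hUpos u₁ hu₁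
  obtain ⟨hps, hpa⟩ := tendsto_tsum_of_tendsto_coeff ha0 hu₁pos (hM.mono fun j hj ↦ hj.1) hp
  obtain ⟨hqs, hqb⟩ := tendsto_tsum_of_tendsto_coeff hb0 hu₁pos (hM.mono fun j hj ↦ hj.2) hq
  -- the open set `V := U ∩ {u < u₁}` is non-empty (it contains `u₁ - ε/2`)
  set V : Set (ι → ℝ) := U ∩ {u | ∀ i, u i < u₁ i} with hV
  have hVopen : IsOpen V := hU.inter (by
    rw [Set.setOf_forall]
    exact isOpen_iInter_of_finite fun i ↦ isOpen_lt (continuous_apply i) continuous_const)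
  have hVne : V.Nonempty := by
    obtain ⟨ε, hε, hball⟩ := Metric.isOpen_iff.1 hU u₁ hu₁
    refine ⟨fun i ↦ u₁ i - ε / 2, hball ?_, fun i ↦ by linarith⟩
    rw [mem_ball, dist_pi_lt_iff hε]
    intro i
    rw [Real.dist_eq, show u₁ i - ε / 2 - u₁ i = -(ε / 2) by ring, abs_neg,
      abs_of_pos (half_pos hε)]
    exact half_lt_self hε
  have hVc : ∀ u ∈ V, ∀ i, 0 < u i ∧ u i < u₁ i := fun u hu i ↦ ⟨hUpos u hu.1 i, hu.2 i⟩
  refine eq_of_tsum_mul_prod_pow_eq hp0 hq0 hps hqs hVopen hVne hVc fun u hu ↦ ?_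
  have h1 := (hpa u fun i ↦ ⟨(hVc u hu i).1.le, (hVc u hu i).2⟩).sub
    (hqb u fun i ↦ ⟨(hVc u hu i).1.le, (hVc u hu i).2⟩)
  exact sub_eq_zero.1 (tendsto_nhds_unique h1 (hlim u hu.1))

/-- **PGF uniqueness in limit form, for coefficient sequences.** Two sequences `a j, b j` of
`[0, 1]`-valued coefficient families on `ℕ^ι` whose generating functions `Σ_k a j k u^k`,
`Σ_k b j k u^k` are eventually bounded and asymptotically equal for every `u` in a non-empty open
set of positive vectors are asymptotically equal coefficientwise.  Proof: every subsequence has a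
further subsequence along which `a` and `b` converge coefficientwise (sequential compactness of
`([0,1]²)^{ℕ^ι}`), and the two limits coincide (`eq_of_tendsto_coeff`);
`Filter.tendsto_of_subseq_tendsto`. -/
theorem tendsto_coeff_sub_of_tsum : ∀ {ι : Type*} [Fintype ι] {a b : ℕ → (ι → ℕ) → ℝ},
    (∀ j k, 0 ≤ a j k) → (∀ j k, 0 ≤ b j k) → (∀ j k, a j k ≤ 1) → (∀ j k, b j k ≤ 1) →
    ∀ {U : Set (ι → ℝ)}, IsOpen U → U.Nonempty → (∀ u ∈ U, ∀ i, 0 < u i) →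
    (∀ u ∈ U, ∃ M : ℝ, ∀ᶠ j in atTop, (Summable (fun k ↦ a j k * ∏ i, u i ^ k i) ∧
      ∑' k, a j k * ∏ i, u i ^ k i ≤ M) ∧ (Summable (fun k ↦ b j k * ∏ i, u i ^ k i) ∧
      ∑' k, b j k * ∏ i, u i ^ k i ≤ M)) →
    (∀ u ∈ U, Tendsto (fun j ↦ ∑' k, a j k * ∏ i, u i ^ k i - ∑' k, b j k * ∏ i, u i ^ k i)
      atTop (𝓝 0)) → ∀ k : ι → ℕ, Tendsto (fun j ↦ a j k - b j k) atTop (𝓝 0) := by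
  intro ι _ a b ha0 hb0 ha1 hb1 U hU hUne hUpos hbd hlim k
  refine tendsto_of_subseq_tendsto fun ψ hψ ↦ ?_
  have hcpt : IsCompact (Set.pi univ fun _ : ι → ℕ ↦ Icc (0 : ℝ) 1 ×ˢ Icc (0 : ℝ) 1) :=
    isCompact_univ_pi fun _ ↦ isCompact_Icc.prod isCompact_Icc
  obtain ⟨L, -, φ, hφ, hL⟩ := hcpt.tendsto_subseq (x := fun n k ↦ (a (ψ n) k, b (ψ n) k))
    fun n k _ ↦ ⟨⟨ha0 _ _, ha1 _ _⟩, ⟨hb0 _ _, hb1 _ _⟩⟩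
  rw [tendsto_pi_nhds] at hL
  have hθ : Tendsto (ψ ∘ φ) atTop atTop := hψ.comp hφ.tendsto_atTop
  have hp : ∀ k, Tendsto (fun j ↦ a (ψ (φ j)) k) atTop (𝓝 (L k).1) := fun k ↦
    (continuous_fst.tendsto _).comp (hL k)
  have hq : ∀ k, Tendsto (fun j ↦ b (ψ (φ j)) k) atTop (𝓝 (L k).2) := fun k ↦
    (continuous_snd.tendsto _).comp (hL k)
  have hpq := eq_of_tendsto_coeff (a := fun j ↦ a (ψ (φ j))) (b := fun j ↦ b (ψ (φ j)))
    (fun j k ↦ ha0 _ _) (fun j k ↦ hb0 _ _) hU hUne hUpos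
    (fun u hu ↦ by obtain ⟨M, hM⟩ := hbd u hu; exact ⟨M, hθ.eventually hM⟩)
    (fun u hu ↦ (hlim u hu).comp hθ) hp hq
  refine ⟨φ, ?_⟩
  have h := (hp k).sub (hq k)
  rwa [show (L k).1 - (L k).2 = 0 by rw [sub_eq_zero]; exact congrFun hpq k] at h

end Summit.CriticalPhenomena.CardyFormulaZ2.Cruxes.NestingRigidity.PositiveConeWeightDoubling

end
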